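import Mathlib
import Summits.Ventures.PercRepro2.Defs
import Summits.Ventures.PercRepro2.Independence
import Summits.Ventures.PercRepro2.Harris
import Summits.Ventures.PercRepro2.BoxUnionDefs
import Summits.Ventures.PercRepro2.BoxUnionShapeWitness
import Summits.Ventures.PercRepro2.BoxUnionFaceWitness

/-!
# The five bad 2-face traces with explicit increasing-event indicators
(blind cell PercRepro2, mine-1 g37; paper proof proofs/MINE1-BOXUNION-SHAPE.md, part B)

The witnesses of `BoxUnionFaceWitness.lean` are existential.  For the EVENT form of the shape
theorem (the restricted Harris inequality for increasing events) we need them with the observables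
named: here `f = 1_{↑c}`, `g = 1_{↑c'}` are `Set.indicator`s of principal up-sets
(`(Set.Ici c).indicator 1`), so that `expect p f = prob p (Set.Ici c)`
(`prob_eq_expect_indicator`).  For a face weight `p` (`p i = p j = 1/2`, `p e = x e` elsewhere)
and each bad trace of `U` on the face at `x` spanned by `i ≠ j`, the restricted covariance is
negative: `-1/32` (`{d}`, `{d'}`), `-1/8` (`{d, d'}`), `-1/16` (`{m, d, d'}`, `{d, d', s}`).
-/

namespace Summit.Ventures.PercRepro2

open Finset BoxUnion

open scoped Classical

noncomputable section

section Traces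

variable {E : Type*} [Fintype E] [DecidableEq E]

/-- Trace `{d}`: `f = 1_{↑s}`, `g = 1_{↑d}` (`d = x[i↦1]`, `s = x[i↦1][j↦1]`). -/
theorem face_trace_d_cov {x : Config E} {i j : E} (hij : i ≠ j) (hxi : x i = false)
    (hxj : x j = false) {p : E → ℝ} (hpi : p i = 1 / 2) (hpj : p j = 1 / 2)
    (hpe : ∀ e, e ≠ i → e ≠ j → p e = if x e then 1 else 0) {U : Set (Config E)} (h0 : x ∉ U)
    (h1 : Function.update x i true ∈ U) (h2 : Function.update x j true ∉ U)
    (h3 : Function.update (Function.update x i true) j true ∉ U) :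
    (∑ ω, if ω ∈ U then weight p ω *
      (((Set.Ici (Function.update (Function.update x i true) j true)).indicator 1 ω -
        expect p ((Set.Ici (Function.update (Function.update x i true) j true)).indicator 1)) *
       ((Set.Ici (Function.update x i true)).indicator 1 ω -
        expect p ((Set.Ici (Function.update x i true)).indicator 1))) else 0) < 0 := by
  rw [face_cov_sum hij hxi hxj hpi hpj hpe, expect_face hij hxi hxj hpi hpj hpe,
    expect_face hij hxi hxj hpi hpj hpe]
  have a1 : ¬ Function.update (Function.update x i true) j true ≤ x :=
    not_le_of_coord i (by simp [hij]) hxi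
  have a2 : ¬ Function.update (Function.update x i true) j true ≤ Function.update x i true :=
    not_le_of_coord j (by simp) (by simp [hij.symm, hxj])
  have a3 : ¬ Function.update (Function.update x i true) j true ≤ Function.update x j true :=
    not_le_of_coord i (by simp [hij]) (by simp [hij, hxi])
  have b1 : ¬ Function.update x i true ≤ x := not_le_of_coord i (by simp) hxi
  have b3 : ¬ Function.update x i true ≤ Function.update x j true :=
    not_le_of_coord i (by simp) (by simp [hij, hxi])
  simp only [Set.indicator_apply, Set.mem_Ici, Pi.one_apply, h0, h1, h2, h3, a1, a2, a3, b1, b3,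
    le_refl, face_le_ij, if_true, if_false]
  norm_num

/-- Trace `{d'}`: `f = 1_{↑s}`, `g = 1_{↑d'}` (`d' = x[j↦1]`). -/
theorem face_trace_d'_cov {x : Config E} {i j : E} (hij : i ≠ j) (hxi : x i = false)
    (hxj : x j = false) {p : E → ℝ} (hpi : p i = 1 / 2) (hpj : p j = 1 / 2)
    (hpe : ∀ e, e ≠ i → e ≠ j → p e = if x e then 1 else 0) {U : Set (Config E)} (h0 : x ∉ U)
    (h1 : Function.update x i true ∉ U) (h2 : Function.update x j true ∈ U)
    (h3 : Function.update (Function.update x i true) j true ∉ U) :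
    (∑ ω, if ω ∈ U then weight p ω *
      (((Set.Ici (Function.update (Function.update x i true) j true)).indicator 1 ω -
        expect p ((Set.Ici (Function.update (Function.update x i true) j true)).indicator 1)) *
       ((Set.Ici (Function.update x j true)).indicator 1 ω -
        expect p ((Set.Ici (Function.update x j true)).indicator 1))) else 0) < 0 := by
  rw [face_cov_sum hij hxi hxj hpi hpj hpe, expect_face hij hxi hxj hpi hpj hpe,
    expect_face hij hxi hxj hpi hpj hpe]
  have a1 : ¬ Function.update (Function.update x i true) j true ≤ x :=
    not_le_of_coord i (by simp [hij]) hxi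
  have a2 : ¬ Function.update (Function.update x i true) j true ≤ Function.update x i true :=
    not_le_of_coord j (by simp) (by simp [hij.symm, hxj])
  have a3 : ¬ Function.update (Function.update x i true) j true ≤ Function.update x j true :=
    not_le_of_coord i (by simp [hij]) (by simp [hij, hxi])
  have c1 : ¬ Function.update x j true ≤ x := not_le_of_coord j (by simp) hxj
  have c2 : ¬ Function.update x j true ≤ Function.update x i true :=
    not_le_of_coord j (by simp) (by simp [hij.symm, hxj])
  simp only [Set.indicator_apply, Set.mem_Ici, Pi.one_apply, h0, h1, h2, h3, a1, a2, a3, c1, c2,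
    le_refl, face_le_ji, if_true, if_false]
  norm_num

/-- Trace `{d, d'}`: `f = 1_{↑d}`, `g = 1_{↑d'}`. -/
theorem face_trace_dd'_cov {x : Config E} {i j : E} (hij : i ≠ j) (hxi : x i = false)
    (hxj : x j = false) {p : E → ℝ} (hpi : p i = 1 / 2) (hpj : p j = 1 / 2)
    (hpe : ∀ e, e ≠ i → e ≠ j → p e = if x e then 1 else 0) {U : Set (Config E)} (h0 : x ∉ U)
    (h1 : Function.update x i true ∈ U) (h2 : Function.update x j true ∈ U)
    (h3 : Function.update (Function.update x i true) j true ∉ U) :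
    (∑ ω, if ω ∈ U then weight p ω *
      (((Set.Ici (Function.update x i true)).indicator 1 ω -
        expect p ((Set.Ici (Function.update x i true)).indicator 1)) *
       ((Set.Ici (Function.update x j true)).indicator 1 ω -
        expect p ((Set.Ici (Function.update x j true)).indicator 1))) else 0) < 0 := by
  rw [face_cov_sum hij hxi hxj hpi hpj hpe, expect_face hij hxi hxj hpi hpj hpe,
    expect_face hij hxi hxj hpi hpj hpe]
  have b1 : ¬ Function.update x i true ≤ x := not_le_of_coord i (by simp) hxi
  have b3 : ¬ Function.update x i true ≤ Function.update x j true :=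
    not_le_of_coord i (by simp) (by simp [hij, hxi])
  have c1 : ¬ Function.update x j true ≤ x := not_le_of_coord j (by simp) hxj
  have c2 : ¬ Function.update x j true ≤ Function.update x i true :=
    not_le_of_coord j (by simp) (by simp [hij.symm, hxj])
  simp only [Set.indicator_apply, Set.mem_Ici, Pi.one_apply, h0, h1, h2, h3, b1, b3, c1, c2,
    le_refl, face_le_ij, face_le_ji, if_true, if_false]
  norm_num

/-- Trace `{m, d, d'}` (the face minus its top): `f = 1_{↑d}`, `g = 1_{↑d'}`. -/
theorem face_trace_top_cov {x : Config E} {i j : E} (hij : i ≠ j) (hxi : x i = false)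
    (hxj : x j = false) {p : E → ℝ} (hpi : p i = 1 / 2) (hpj : p j = 1 / 2)
    (hpe : ∀ e, e ≠ i → e ≠ j → p e = if x e then 1 else 0) {U : Set (Config E)} (h0 : x ∈ U)
    (h1 : Function.update x i true ∈ U) (h2 : Function.update x j true ∈ U)
    (h3 : Function.update (Function.update x i true) j true ∉ U) :
    (∑ ω, if ω ∈ U then weight p ω *
      (((Set.Ici (Function.update x i true)).indicator 1 ω -
        expect p ((Set.Ici (Function.update x i true)).indicator 1)) *
       ((Set.Ici (Function.update x j true)).indicator 1 ω -
        expect p ((Set.Ici (Function.update x j true)).indicator 1))) else 0) < 0 := by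
  rw [face_cov_sum hij hxi hxj hpi hpj hpe, expect_face hij hxi hxj hpi hpj hpe,
    expect_face hij hxi hxj hpi hpj hpe]
  have b1 : ¬ Function.update x i true ≤ x := not_le_of_coord i (by simp) hxi
  have b3 : ¬ Function.update x i true ≤ Function.update x j true :=
    not_le_of_coord i (by simp) (by simp [hij, hxi])
  have c1 : ¬ Function.update x j true ≤ x := not_le_of_coord j (by simp) hxj
  have c2 : ¬ Function.update x j true ≤ Function.update x i true :=
    not_le_of_coord j (by simp) (by simp [hij.symm, hxj])
  simp only [Set.indicator_apply, Set.mem_Ici, Pi.one_apply, h0, h1, h2, h3, b1, b3, c1, c2,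
    le_refl, face_le_ij, face_le_ji, if_true, if_false]
  norm_num

/-- Trace `{d, d', s}` (the face minus its bottom): `f = 1_{↑d}`, `g = 1_{↑d'}`. -/
theorem face_trace_bot_cov {x : Config E} {i j : E} (hij : i ≠ j) (hxi : x i = false)
    (hxj : x j = false) {p : E → ℝ} (hpi : p i = 1 / 2) (hpj : p j = 1 / 2)
    (hpe : ∀ e, e ≠ i → e ≠ j → p e = if x e then 1 else 0) {U : Set (Config E)} (h0 : x ∉ U)
    (h1 : Function.update x i true ∈ U) (h2 : Function.update x j true ∈ U)
    (h3 : Function.update (Function.update x i true) j true ∈ U) :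
    (∑ ω, if ω ∈ U then weight p ω *
      (((Set.Ici (Function.update x i true)).indicator 1 ω -
        expect p ((Set.Ici (Function.update x i true)).indicator 1)) *
       ((Set.Ici (Function.update x j true)).indicator 1 ω -
        expect p ((Set.Ici (Function.update x j true)).indicator 1))) else 0) < 0 := by
  rw [face_cov_sum hij hxi hxj hpi hpj hpe, expect_face hij hxi hxj hpi hpj hpe,
    expect_face hij hxi hxj hpi hpj hpe]
  have b1 : ¬ Function.update x i true ≤ x := not_le_of_coord i (by simp) hxi
  have b3 : ¬ Function.update x i true ≤ Function.update x j true :=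
    not_le_of_coord i (by simp) (by simp [hij, hxi])
  have c1 : ¬ Function.update x j true ≤ x := not_le_of_coord j (by simp) hxj
  have c2 : ¬ Function.update x j true ≤ Function.update x i true :=
    not_le_of_coord j (by simp) (by simp [hij.symm, hxj])
  simp only [Set.indicator_apply, Set.mem_Ici, Pi.one_apply, h0, h1, h2, h3, b1, b3, c1, c2,
    le_refl, face_le_ij, face_le_ji, if_true, if_false]
  norm_num

end Traces

end

end Summit.Ventures.PercRepro2
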